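import Literature.NumberTheory.Transcendental.SemistableTorsion
import Literature.NumberTheory.Transcendental.IndexDescent
import Literature.NumberTheory.Transcendental.SemistableNoSubgroup
import Literature.NumberTheory.Transcendental.PkappaThetaPoints
import HarnessLib

/-!
# Connected algebraic subgroups of `M_κ` are again of type `M_κ'` (transport to a subgroup)

Topic: `Literature/NumberTheory/Transcendental`. Plan item W4 (closing, part 9) of the unit
`provefact-Literature.NumberTheory.Transcendental.H-b596640137`. The second half of the
inductive step of the Semistability Theorem over a borderline subgroup `K₀ = H_{(A₀,C₀,Ξ₀)}` of
`M_κ = 𝔾ₘ^β × P_κ` (Baker–Wüstholz, *Logarithmic Forms and Diophantine Geometry*, §6.8, p. 115: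
"A second application of the inductive hypothesis applied now to `B ∩ ker π` and `ker π`") needs
the subgroup `K₀` itself as a standard model `M_κ'`: `K₀ = T' × P'` with `T'` the subtorus cut
out by `A₀` (Lie coordinates: a unimodular family of integer vectors `a⁽ʲ⁾` spanning `A₀^⊥`),
`P'` the extension of the abelian subvariety `B = (C₀-killed) ≅ E^{γ'}` (integer vectors `m⁽ᵇ⁾`
spanning `C₀^⊥`) by the vector group `Ξ₀^⊥` (a `ℚ̄`-basis `σ⁽ᵉ⁾`), which is the push-out of
`(E♮)^{γ'}` along `κ' : κ ∘ m⁽ᵇ⁾ = ∑_e κ'_{eb} σ⁽ᵉ⁾` (the compatibility `ξ ∘ κ ∈ span C₀` puts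
`κ ∘ m⁽ᵇ⁾` in `Ξ₀^⊥`). Everything is PROVED:

* `Std.SubData`, `nonempty_subData`; the embedding `ι : Lie M_κ' → Lie M_κ` with image `Lie K₀`
  (`ι_mem_tangent`, `exists_eq_ι`), injective (`pA_ι`, `pC_ι`, `eq_zero_of_sv_sum`);
* `ι_mem_ker` (`ker' ↦ ker`), `mem_AlgTors_of_ι` (algebraic points of `K₀` with torsion abelian
  part come from such points of `M_κ'`);
* `isKRational_comap` (`ι⁻¹(𝔟)` is `ℚ̄`-rational), `finrank_comap_ι`, `card_eq`;
* `push` (subgroups of `M_κ'` ↦ subgroups of `M_κ` inside `K₀`), `push_tangent`;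
* `SubData.transport` — for a semistable `ℚ̄`-rational proper `𝔟` and a BORDERLINE
  `0 ≠ K₀ ≠ M_κ`, `ι⁻¹(𝔟) = 𝔟 ∩ 𝔨₀` (in the coordinates of `M_κ'`) is `ℚ̄`-rational, proper and
  SEMISTABLE in `M_κ'` (the mediant inequality `τ(𝔨) ≥ τ(0) = τ(𝔨₀)` for `𝔨 ⊆ 𝔨₀`).

## References

* A. Baker, G. Wüstholz, *Logarithmic Forms and Diophantine Geometry*, CUP 2007, §6.7, §6.8 (p. 115).
-/

noncomputable section

open Module Submodule Complex
open scoped PeriodPair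

namespace Literature.NumberTheory.Transcendental

namespace GaGmE

namespace Std

open LiePresentation

variable {β γ δ : Type} [Fintype β] [Fintype γ] [Fintype δ] {κM : δ → γ → Kbar}

/-! ### Orthogonal complements of the data -/

/-- The rational vectors killed by a space of rational forms. [folklore] -/
def perpQ {ι : Type} [Fintype ι] (A : Submodule ℚ (ι → ℚ)) : Submodule ℚ (ι → ℚ) where
  carrier := {p | ∀ q ∈ A, ∑ i, q i * p i = 0}
  zero_mem' := fun q _ => by simp
  add_mem' := by
    intro u v hu hv q hq
    simp only [Pi.add_apply, mul_add, Finset.sum_add_distrib, hu q hq, hv q hq, add_zero]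
  smul_mem' := by
    intro c u hu q hq
    simp only [Pi.smul_apply, smul_eq_mul, mul_left_comm _ c, ← Finset.mul_sum, hu q hq, mul_zero]

/-- The `ℚ̄`-vectors killed by a space of `ℚ̄`-forms. [folklore] -/
def perpK (Ξ : Submodule Kbar (δ → Kbar)) : Submodule Kbar (δ → Kbar) where
  carrier := {u | ∀ ξ ∈ Ξ, ∑ x, ξ x * u x = 0}
  zero_mem' := fun ξ _ => by simp
  add_mem' := by
    intro u v hu hv ξ hξ
    simp only [Pi.add_apply, mul_add, Finset.sum_add_distrib, hu ξ hξ, hv ξ hξ, add_zero]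
  smul_mem' := by
    intro c u hu ξ hξ
    simp only [Pi.smul_apply, smul_eq_mul, mul_left_comm _ c, ← Finset.mul_sum, hu ξ hξ, mul_zero]

/-! ### Coordinates on `K₀` -/

/-- **Coordinates of `Lie K₀` presenting `K₀ = H_{(A₀, C₀, Ξ₀)}` as a standard model `M_κ'`**:
integer vectors `a⁽ʲ⁾` spanning `A₀^⊥` with an integer left inverse `pA` (`a⁽ʲ⁾ · pA⁽ʲ'⁾ = δ_{jj'}`),
integer vectors `m⁽ᵇ⁾` spanning `C₀^⊥` with an integer left inverse `pC`, a linearly independent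
`ℚ̄`-family `σ⁽ᵉ⁾` spanning `Ξ₀^⊥`, and the push-out matrix `κ'` with
`κ ∘ m⁽ᵇ⁾ = ∑_e κ'_{eb} σ⁽ᵉ⁾`. [folklore] -/
structure SubData (D₀ : SubgroupData β γ δ κM) where
  /-- number of `𝔾ₘ`-coordinates of `K₀` -/
  nA : ℕ
  /-- the integer vectors `a⁽ʲ⁾ ∈ A₀^⊥` -/
  av : Fin nA → β → ℤ
  av_perp : ∀ q ∈ D₀.A, ∀ j, ∑ i, q i * (av j i : ℚ) = 0
  av_span : ∀ p : β → ℚ, (∀ q ∈ D₀.A, ∑ i, q i * p i = 0) → p ∈ Submodule.span ℚ (Set.range fun j i => (av j i : ℚ))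
  /-- the integer left inverse -/
  pA : Fin nA → β → ℤ
  pA_spec : ∀ j j', ∑ i, av j i * pA j' i = if j = j' then 1 else 0
  /-- number of `E`-coordinates of `K₀` -/
  nC : ℕ
  /-- the integer vectors `m⁽ᵇ⁾ ∈ C₀^⊥` -/
  mv : Fin nC → γ → ℤ
  mv_perp : ∀ c ∈ D₀.C, ∀ b, ∑ k, c k * (mv b k : ℚ) = 0
  mv_span : ∀ p : γ → ℚ, (∀ c ∈ D₀.C, ∑ k, c k * p k = 0) → p ∈ Submodule.span ℚ (Set.range fun b k => (mv b k : ℚ))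
  /-- the integer left inverse -/
  pC : Fin nC → γ → ℤ
  pC_spec : ∀ b b', ∑ k, mv b k * pC b' k = if b = b' then 1 else 0
  /-- number of vector-group coordinates of `K₀` -/
  nΞ : ℕ
  /-- the `ℚ̄`-vectors `σ⁽ᵉ⁾ ∈ Ξ₀^⊥` -/
  sv : Fin nΞ → δ → Kbar
  sv_perp : ∀ ξ ∈ D₀.Ξ, ∀ e, ∑ x, ξ x * sv e x = 0
  sv_span : ∀ u : δ → Kbar, (∀ ξ ∈ D₀.Ξ, ∑ x, ξ x * u x = 0) → u ∈ Submodule.span Kbar (Set.range sv)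
  sv_indep : LinearIndependent Kbar sv
  /-- the push-out matrix `κ'` of the subgroup -/
  κS : Fin nΞ → Fin nC → Kbar
  κS_spec : ∀ b x, ∑ k, κM x k * (mv b k : Kbar) = ∑ e, κS e b * sv e x

/-- A unimodular spanning family of a rational subspace with a left inverse. [folklore] -/
theorem exists_unimodular_with_leftInverse {ι : Type} [Fintype ι] (V : Submodule ℚ (ι → ℚ)) :
    ∃ (n : ℕ) (q : Fin n → ι → ℤ) (p : Fin n → ι → ℤ), (∀ j, (fun i => (q j i : ℚ)) ∈ V) ∧
      (∀ v ∈ V, v ∈ Submodule.span ℚ (Set.range fun j i => (q j i : ℚ))) ∧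
      ∀ j j', ∑ i, q j i * p j' i = if j = j' then 1 else 0 := by
  classical
  obtain ⟨n, q, hq, hspan, hunimod⟩ := exists_unimodular_basis V
  choose p hp using fun j' => hunimod (Pi.single j' 1)
  refine ⟨n, q, p, hq, hspan, fun j j' => ?_⟩
  rw [hp j' j, Pi.single_apply]

/-- A `ℚ̄`-basis of `Ξ₀^⊥`. [folklore] -/
theorem exists_sv (Ξ : Submodule Kbar (δ → Kbar)) :
    ∃ (n : ℕ) (sv : Fin n → δ → Kbar), (∀ e, sv e ∈ perpK Ξ) ∧
      (∀ u ∈ perpK Ξ, u ∈ Submodule.span Kbar (Set.range sv)) ∧ LinearIndependent Kbar sv := by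
  let V := perpK Ξ
  let bΞ := Module.finBasis Kbar V
  let sv : Fin (finrank Kbar V) → δ → Kbar := fun e => (bΞ e : δ → Kbar)
  have sv_mem : ∀ e, sv e ∈ V := fun e => (bΞ e).2
  have sv_span : ∀ u ∈ V, u ∈ Submodule.span Kbar (Set.range sv) := by
    intro u hu
    have e : u = ∑ e, (bΞ.repr ⟨u, hu⟩ e) • sv e := by
      have h := congrArg (fun x : V => (x : δ → Kbar)) (bΞ.sum_repr ⟨u, hu⟩)
      simp only [Submodule.coe_sum, Submodule.coe_smul] at h
      exact h.symm
    rw [e]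
    exact Submodule.sum_mem _ fun e _ => Submodule.smul_mem _ _ (Submodule.subset_span ⟨e, rfl⟩)
  have sv_indep : LinearIndependent Kbar sv :=
    bΞ.linearIndependent.map' V.subtype (Submodule.ker_subtype _)
  exact ⟨finrank Kbar V, sv, sv_mem, sv_span, sv_indep⟩

/-- The push-out matrix of the subgroup: `κ ∘ m⁽ᵇ⁾ ∈ Ξ₀^⊥` is a combination of the `σ⁽ᵉ⁾`.
[folklore] -/
theorem exists_κS (D₀ : SubgroupData β γ δ κM) {nC : ℕ} (mv : Fin nC → γ → ℤ)
    (hmv : ∀ b, (fun k => (mv b k : ℚ)) ∈ perpQ D₀.C) {n : ℕ} {sv : Fin n → δ → Kbar}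
    (sv_span : ∀ u ∈ perpK D₀.Ξ, u ∈ Submodule.span Kbar (Set.range sv)) :
    ∃ κS : Fin n → Fin nC → Kbar, ∀ b x, ∑ k, κM x k * (mv b k : Kbar) = ∑ e, κS e b * sv e x := by
  -- `κ ∘ m⁽ᵇ⁾ ∈ Ξ₀^⊥`
  have hκmem : ∀ b, (fun x => ∑ k, κM x k * (mv b k : Kbar)) ∈ perpK D₀.Ξ := by
    intro b ξ hξ
    have hc := D₀.compat ξ hξ
    have key : ∀ lam ∈ Submodule.span Kbar ((fun c : γ → ℚ => fun k => (c k : Kbar)) '' (D₀.C : Set (γ → ℚ))),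
        ∑ k, lam k * (mv b k : Kbar) = 0 := by
      intro lam hlam
      induction hlam using Submodule.span_induction with
      | mem x hx =>
        obtain ⟨c, hcC, rfl⟩ := hx
        have h0 : ∑ k, c k * (mv b k : ℚ) = 0 := hmv b c hcC
        have := congrArg (fun r : ℚ => (r : Kbar)) h0
        push_cast at this
        exact this
      | zero => simp
      | add x y _ _ hx hy => simp [add_mul, Finset.sum_add_distrib, hx, hy]
      | smul r x _ hx => simp [mul_assoc, ← Finset.mul_sum, hx]
    have h1 := key _ hc
    show ∑ x, ξ x * ∑ k, κM x k * (mv b k : Kbar) = 0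
    rw [← h1]
    simp only [Finset.mul_sum, Finset.sum_mul]
    rw [Finset.sum_comm]
    exact Finset.sum_congr rfl fun k _ => Finset.sum_congr rfl fun x _ => by ring
  have hκ : ∀ b, ∃ r : Fin n → Kbar, (∑ e, r e • sv e) = fun x => ∑ k, κM x k * (mv b k : Kbar) := by
    intro b
    have := sv_span _ (hκmem b)
    rwa [Submodule.mem_span_range_iff_exists_fun] at this
  choose κS hκS using hκ
  refine ⟨fun e b => κS b e, fun b x => ?_⟩
  have := congr_fun (hκS b) x
  simp only [Finset.sum_apply, Pi.smul_apply, smul_eq_mul] at this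
  rw [← this]

/-- Adapted coordinates on `K₀` exist. [folklore] -/
theorem nonempty_subData (D₀ : SubgroupData β γ δ κM) : Nonempty (SubData D₀) := by
  obtain ⟨nA, av, pA, hav, hspanA, hpA⟩ := exists_unimodular_with_leftInverse (perpQ D₀.A)
  obtain ⟨nC, mv, pC, hmv, hspanC, hpC⟩ := exists_unimodular_with_leftInverse (perpQ D₀.C)
  obtain ⟨nΞ, sv, sv_mem, sv_span, sv_indep⟩ := exists_sv D₀.Ξ
  obtain ⟨κS, hκS⟩ := exists_κS D₀ mv hmv sv_span
  exact ⟨⟨nA, av, fun q hq j => hav j q hq, fun p hp => hspanA p hp, pA, hpA, nC, mv, fun c hc b => hmv b c hc,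
    fun p hp => hspanC p hp, pC, hpC, nΞ, sv, fun ξ hξ e => sv_mem e ξ hξ, fun u hu => sv_span u hu,
    sv_indep, κS, hκS⟩⟩

namespace SubData

variable {D₀ : SubgroupData β γ δ κM} (S : SubData D₀)

/-- The index type of the coordinates of `Lie K₀ = Lie M_κ'`. [folklore] -/
abbrev σ' : Type := Fin S.nA ⊕ (Fin S.nC ⊕ Fin S.nΞ)

/-- The embedding `ι : Lie M_κ' = Lie K₀ → Lie M_κ` in adapted coordinates. [folklore] -/
def ι : (S.σ' → ℂ) →ₗ[ℂ] (β ⊕ (γ ⊕ δ) → ℂ) where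
  toFun w := Std.coords (fun i => ∑ j, (S.av j i : ℂ) * w (iy j))
    (fun k => ∑ b, (S.mv b k : ℂ) * w (iz b))
    (fun x => ∑ e, (S.sv e x : ℂ) * w (is e))
  map_add' v w := by
    funext x
    rcases x with i | k | x
    · simp only [Std.coords, Sum.elim_inl, Pi.add_apply, mul_add, Finset.sum_add_distrib]
    · simp only [Std.coords, Sum.elim_inr, Sum.elim_inl, Pi.add_apply, mul_add,
        Finset.sum_add_distrib]
    · simp only [Std.coords, Sum.elim_inr, Pi.add_apply, mul_add, Finset.sum_add_distrib]
  map_smul' c w := by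
    funext x
    rcases x with i | k | x
    · simp only [Std.coords, Sum.elim_inl, Pi.smul_apply, smul_eq_mul, RingHom.id_apply,
        Finset.mul_sum]
      exact Finset.sum_congr rfl fun i _ => by ring
    · simp only [Std.coords, Sum.elim_inr, Sum.elim_inl, Pi.smul_apply, smul_eq_mul,
        RingHom.id_apply, Finset.mul_sum]
      exact Finset.sum_congr rfl fun i _ => by ring
    · simp only [Std.coords, Sum.elim_inr, Pi.smul_apply, smul_eq_mul, RingHom.id_apply,
        Finset.mul_sum]
      exact Finset.sum_congr rfl fun i _ => by ring

/-- The `y`-block of `ι`. [folklore] -/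
theorem ι_iy (w) (i : β) : S.ι w (iy i) = ∑ j, (S.av j i : ℂ) * w (iy j) := rfl
/-- The `z`-block of `ι`. [folklore] -/
theorem ι_iz (w) (k : γ) : S.ι w (iz k) = ∑ b, (S.mv b k : ℂ) * w (iz b) := rfl
/-- The `s`-block of `ι`. [folklore] -/
theorem ι_is (w) (x : δ) : S.ι w (is x) = ∑ e, (S.sv e x : ℂ) * w (is e) := rfl

/-- The integer left inverse on the `y`-block: `∑_i pA_{j'i} (ι w)_i = w_{j'}`. [folklore] -/
theorem pA_ι (w : S.σ' → ℂ) (j' : Fin S.nA) : ∑ i, (S.pA j' i : ℂ) * S.ι w (iy i) = w (iy j') := by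
  simp only [ι_iy, Finset.mul_sum]
  rw [Finset.sum_comm]
  have key : ∀ j, ∑ i, (S.pA j' i : ℂ) * ((S.av j i : ℂ) * w (iy j)) = (if j = j' then 1 else 0) * w (iy j) := by
    intro j
    have h := congrArg (fun n : ℤ => (n : ℂ)) (S.pA_spec j j')
    push_cast at h
    rw [← h, Finset.sum_mul]
    exact Finset.sum_congr rfl fun i _ => by ring
  simp only [key, ite_mul, one_mul, zero_mul, Finset.sum_ite_eq', Finset.mem_univ, if_true]

/-- The integer left inverse on the `z`-block: `∑_k pC_{b'k} (ι w)_k = w_{b'}`. [folklore] -/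
theorem pC_ι (w : S.σ' → ℂ) (b' : Fin S.nC) : ∑ k, (S.pC b' k : ℂ) * S.ι w (iz k) = w (iz b') := by
  simp only [ι_iz, Finset.mul_sum]
  rw [Finset.sum_comm]
  have key : ∀ b, ∑ k, (S.pC b' k : ℂ) * ((S.mv b k : ℂ) * w (iz b)) = (if b = b' then 1 else 0) * w (iz b) := by
    intro b
    have h := congrArg (fun n : ℤ => (n : ℂ)) (S.pC_spec b b')
    push_cast at h
    rw [← h, Finset.sum_mul]
    exact Finset.sum_congr rfl fun k _ => by ring
  simp only [key, ite_mul, one_mul, zero_mul, Finset.sum_ite_eq', Finset.mem_univ, if_true]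

/-- The `σ⁽ᵉ⁾` are linearly independent over `ℂ`: `∑_e σ_e(x) c_e = 0` for all `x` forces
`c = 0`. [folklore] -/
theorem eq_zero_of_sv_sum {c : Fin S.nΞ → ℂ} (h : ∀ x, ∑ e, (S.sv e x : ℂ) * c e = 0) : c = 0 := by
  have hind := linearIndependent_ofK (L := ℂ) S.sv_indep
  have := Fintype.linearIndependent_iff.mp hind c (by
    funext x
    simp only [Finset.sum_apply, Pi.smul_apply, smul_eq_mul, Pi.zero_apply, LiePresentation.ofK_apply]
    rw [← h x]
    exact Finset.sum_congr rfl fun e _ => by rw [mul_comm]; rfl)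
  exact funext this

/-- `ι` is injective. [folklore] -/
theorem ι_injective : Function.Injective S.ι := by
  rw [← LinearMap.ker_eq_bot, LinearMap.ker_eq_bot']
  intro w hw
  funext t
  rcases t with j' | b' | e'
  · have := S.pA_ι w j'; rw [hw] at this
    show w (iy j') = 0
    simpa using this.symm
  · have := S.pC_ι w b'; rw [hw] at this
    show w (iz b') = 0
    simpa using this.symm
  · have hc : (fun e => w (is e)) = 0 := by
      refine S.eq_zero_of_sv_sum fun x => ?_
      have := congr_fun hw (is x)
      rw [ι_is] at this
      simpa using this
    exact congr_fun hc e'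

/-- The image of `ι` lies in `Lie K₀`. [folklore] -/
theorem ι_mem_tangent (w : S.σ' → ℂ) : S.ι w ∈ D₀.tangent := by
  rw [SubgroupData.mem_tangent_iff]
  refine ⟨fun q hq => ?_, fun c hc => ?_, fun ξ hξ => ?_⟩
  · simp only [ι_iy, Finset.mul_sum]
    rw [Finset.sum_comm]
    refine Finset.sum_eq_zero fun j _ => ?_
    have h := congrArg (fun r : ℚ => (r : ℂ)) (S.av_perp q hq j)
    push_cast at h
    have : ∑ i, (q i : ℂ) * ((S.av j i : ℂ) * w (iy j)) = (∑ i, (q i : ℂ) * (S.av j i : ℂ)) * w (iy j) := by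
      rw [Finset.sum_mul]; exact Finset.sum_congr rfl fun i _ => by ring
    rw [this, h, zero_mul]
  · simp only [ι_iz, Finset.mul_sum]
    rw [Finset.sum_comm]
    refine Finset.sum_eq_zero fun b _ => ?_
    have h := congrArg (fun r : ℚ => (r : ℂ)) (S.mv_perp c hc b)
    push_cast at h
    have : ∑ k, (c k : ℂ) * ((S.mv b k : ℂ) * w (iz b)) = (∑ k, (c k : ℂ) * (S.mv b k : ℂ)) * w (iz b) := by
      rw [Finset.sum_mul]; exact Finset.sum_congr rfl fun k _ => by ring
    rw [this, h, zero_mul]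
  · simp only [ι_is, Finset.mul_sum]
    rw [Finset.sum_comm]
    refine Finset.sum_eq_zero fun e _ => ?_
    have h := congrArg (algebraMap Kbar ℂ) (S.sv_perp ξ hξ e)
    rw [map_sum, map_zero] at h
    simp only [map_mul] at h
    have : ∑ x, (ξ x : ℂ) * ((S.sv e x : ℂ) * w (is e)) = (∑ x, (ξ x : ℂ) * (S.sv e x : ℂ)) * w (is e) := by
      rw [Finset.sum_mul]; exact Finset.sum_congr rfl fun x _ => by ring
    rw [this]
    exact mul_eq_zero_of_left h _

/-- Complex solutions of the `A₀`-equations are combinations of the `a⁽ʲ⁾`. [folklore] -/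
theorem exists_coeff_y {y : β → ℂ} (hy : ∀ q ∈ D₀.A, ∑ i, (q i : ℂ) * y i = 0) :
    ∃ c : Fin S.nA → ℂ, y = fun i => ∑ j, (S.av j i : ℂ) * c j := by
  -- `y` lies in the solution space of the rational system, spanned by rational solutions
  have hmem : y ∈ solSpace ℚ (L := ℂ) (D₀.A : Set (β → ℚ)) := by
    intro q hq
    simp only [pair, eq_ratCast]
    exact hy q hq
  rw [solSpace_eq_span] at hmem
  have hle : span ℂ (ofK ℚ (L := ℂ) '' {w : β → ℚ | ∀ q ∈ (D₀.A : Set (β → ℚ)), ∑ i, q i * w i = 0}) ≤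
      span ℂ (Set.range fun j => fun i => (S.av j i : ℂ)) := by
    refine span_le.mpr ?_
    rintro _ ⟨w, hw, rfl⟩
    have hw' := S.av_span w hw
    rw [Submodule.mem_span_range_iff_exists_fun] at hw'
    obtain ⟨r, hr⟩ := hw'
    have e : ofK ℚ (L := ℂ) w = ∑ j, (r j : ℂ) • fun i => (S.av j i : ℂ) := by
      funext i
      have := congr_fun hr i
      simp only [Finset.sum_apply, Pi.smul_apply, smul_eq_mul] at this
      simp only [ofK_apply, eq_ratCast, Finset.sum_apply, Pi.smul_apply, smul_eq_mul]
      rw [← this]; push_cast; rfl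
    rw [e]
    exact Submodule.sum_mem _ fun j _ => Submodule.smul_mem _ _ (subset_span ⟨j, rfl⟩)
  have := hle hmem
  rw [Submodule.mem_span_range_iff_exists_fun] at this
  obtain ⟨c, hc⟩ := this
  refine ⟨c, ?_⟩
  funext i
  have := congr_fun hc i
  simp only [Finset.sum_apply, Pi.smul_apply, smul_eq_mul] at this
  rw [← this]
  exact Finset.sum_congr rfl fun j _ => by ring

/-- Complex solutions of the `C₀`-equations are combinations of the `m⁽ᵇ⁾`. [folklore] -/
theorem exists_coeff_z {z : γ → ℂ} (hz : ∀ c ∈ D₀.C, ∑ k, (c k : ℂ) * z k = 0) :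
    ∃ c : Fin S.nC → ℂ, z = fun k => ∑ b, (S.mv b k : ℂ) * c b := by
  have hmem : z ∈ solSpace ℚ (L := ℂ) (D₀.C : Set (γ → ℚ)) := by
    intro c hc
    simp only [pair, eq_ratCast]
    exact hz c hc
  rw [solSpace_eq_span] at hmem
  have hle : span ℂ (ofK ℚ (L := ℂ) '' {w : γ → ℚ | ∀ c ∈ (D₀.C : Set (γ → ℚ)), ∑ k, c k * w k = 0}) ≤
      span ℂ (Set.range fun b => fun k => (S.mv b k : ℂ)) := by
    refine span_le.mpr ?_
    rintro _ ⟨w, hw, rfl⟩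
    have hw' := S.mv_span w hw
    rw [Submodule.mem_span_range_iff_exists_fun] at hw'
    obtain ⟨r, hr⟩ := hw'
    have e : ofK ℚ (L := ℂ) w = ∑ b, (r b : ℂ) • fun k => (S.mv b k : ℂ) := by
      funext k
      have := congr_fun hr k
      simp only [Finset.sum_apply, Pi.smul_apply, smul_eq_mul] at this
      simp only [ofK_apply, eq_ratCast, Finset.sum_apply, Pi.smul_apply, smul_eq_mul]
      rw [← this]; push_cast; rfl
    rw [e]
    exact Submodule.sum_mem _ fun b _ => Submodule.smul_mem _ _ (subset_span ⟨b, rfl⟩)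
  have := hle hmem
  rw [Submodule.mem_span_range_iff_exists_fun] at this
  obtain ⟨c, hc⟩ := this
  refine ⟨c, ?_⟩
  funext k
  have := congr_fun hc k
  simp only [Finset.sum_apply, Pi.smul_apply, smul_eq_mul] at this
  rw [← this]
  exact Finset.sum_congr rfl fun b _ => by ring

/-- Complex solutions of the `Ξ₀`-equations are combinations of the `σ⁽ᵉ⁾`. [folklore] -/
theorem exists_coeff_s {s : δ → ℂ} (hs : ∀ ξ ∈ D₀.Ξ, ∑ x, (ξ x : ℂ) * s x = 0) :
    ∃ c : Fin S.nΞ → ℂ, s = fun x => ∑ e, (S.sv e x : ℂ) * c e := by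
  have hmem : s ∈ solSpace Kbar (L := ℂ) (D₀.Ξ : Set (δ → Kbar)) := by
    intro ξ hξ
    exact hs ξ hξ
  rw [solSpace_eq_span] at hmem
  have hle : span ℂ (ofK Kbar (L := ℂ) '' {w : δ → Kbar | ∀ ξ ∈ (D₀.Ξ : Set (δ → Kbar)), ∑ x, ξ x * w x = 0}) ≤
      span ℂ (Set.range fun e => fun x => (S.sv e x : ℂ)) := by
    refine span_le.mpr ?_
    rintro _ ⟨w, hw, rfl⟩
    have hw' := S.sv_span w hw
    rw [Submodule.mem_span_range_iff_exists_fun] at hw'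
    obtain ⟨r, hr⟩ := hw'
    have e : ofK Kbar (L := ℂ) w = ∑ e, (r e : ℂ) • fun x => (S.sv e x : ℂ) := by
      funext x
      have := congr_fun hr x
      simp only [Finset.sum_apply, Pi.smul_apply, smul_eq_mul] at this
      simp only [ofK_apply, Finset.sum_apply, Pi.smul_apply, smul_eq_mul]
      rw [← this, map_sum]
      exact Finset.sum_congr rfl fun e _ => by rw [map_mul]; rfl
    rw [e]
    exact Submodule.sum_mem _ fun e _ => Submodule.smul_mem _ _ (subset_span ⟨e, rfl⟩)
  have := hle hmem
  rw [Submodule.mem_span_range_iff_exists_fun] at this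
  obtain ⟨c, hc⟩ := this
  refine ⟨c, ?_⟩
  funext x
  have := congr_fun hc x
  simp only [Finset.sum_apply, Pi.smul_apply, smul_eq_mul] at this
  rw [← this]
  exact Finset.sum_congr rfl fun e _ => by ring

/-- **`ι` maps onto `Lie K₀`.** [folklore] -/
theorem exists_eq_ι {w : β ⊕ (γ ⊕ δ) → ℂ} (hw : w ∈ D₀.tangent) : ∃ w', S.ι w' = w := by
  obtain ⟨hA, hC, hΞ⟩ := (SubgroupData.mem_tangent_iff D₀ w).mp hw
  obtain ⟨cy, hcy⟩ := S.exists_coeff_y (y := fun i => w (iy i)) hA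
  obtain ⟨cz, hcz⟩ := S.exists_coeff_z (z := fun k => w (iz k)) hC
  obtain ⟨cs, hcs⟩ := S.exists_coeff_s (s := fun x => w (is x)) hΞ
  refine ⟨Std.coords cy cz cs, ?_⟩
  funext t
  rcases t with i | k | x
  · show S.ι _ (iy i) = w (iy i)
    rw [ι_iy, show w (iy i) = ∑ j, (S.av j i : ℂ) * cy j from congr_fun hcy i]
    rfl
  · show S.ι _ (iz k) = w (iz k)
    rw [ι_iz, show w (iz k) = ∑ b, (S.mv b k : ℂ) * cz b from congr_fun hcz k]
    rfl
  · show S.ι _ (is x) = w (is x)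
    rw [ι_is, show w (is x) = ∑ e, (S.sv e x : ℂ) * cs e from congr_fun hcs x]
    rfl

/-- The range of `ι` is `Lie K₀`. [folklore] -/
theorem range_ι : LinearMap.range S.ι = D₀.tangent := by
  refine le_antisymm ?_ fun w hw => ?_
  · rintro _ ⟨w', rfl⟩; exact S.ι_mem_tangent w'
  · obtain ⟨w', rfl⟩ := S.exists_eq_ι hw; exact LinearMap.mem_range_self _ _

/-- `dim M_κ' = dim K₀`. [folklore] -/
theorem card_eq : Fintype.card S.σ' = finrank ℂ ↥D₀.tangent := by
  rw [← S.range_ι, LinearMap.finrank_range_of_inj S.ι_injective, Module.finrank_fintype_fun_eq_card]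

/-! ### The kernel and the algebraic points -/

/-- `ι` maps `ker(exp_{M_κ'})` into `ker(exp_{M_κ})`. [folklore] -/
theorem ι_mem_ker {L : PeriodPair} {w : S.σ' → ℂ} (hw : w ∈ ker L S.κS) : S.ι w ∈ ker L κM := by
  obtain ⟨hy, a, b, hz, hs⟩ := hw
  choose p hp using hy
  refine ⟨fun i => ⟨∑ j, S.av j i * p j, ?_⟩, fun k => ∑ b', S.mv b' k * a b', fun k => ∑ b', S.mv b' k * b b',
    fun k => ?_, fun x => ?_⟩
  · rw [ι_iy]
    push_cast
    rw [Finset.sum_mul]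
    exact Finset.sum_congr rfl fun j _ => by rw [hp j]; ring
  · rw [ι_iz]
    push_cast
    rw [Finset.sum_mul, Finset.sum_mul, ← Finset.sum_add_distrib]
    exact Finset.sum_congr rfl fun b' _ => by rw [hz b']; ring
  · rw [ι_is]
    have hκ : ∀ b' : Fin S.nC, (∑ k, (κM x k : ℂ) * (S.mv b' k : ℂ)) = ∑ e, (S.κS e b' : ℂ) * (S.sv e x : ℂ) := by
      intro b'
      have := congrArg (algebraMap Kbar ℂ) (S.κS_spec b' x)
      simpa [map_sum, map_mul] using this
    -- left-hand side: `∑_e σ_e(x) · ∑_b' κ'_{eb'} (a η₁ + b η₂)`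
    simp only [hs]
    push_cast
    calc ∑ e, (S.sv e x : ℂ) * ∑ b', (S.κS e b' : ℂ) * ((a b' : ℂ) * L.η₁ + (b b' : ℂ) * L.η₂)
        = ∑ b', (∑ e, (S.κS e b' : ℂ) * (S.sv e x : ℂ)) * ((a b' : ℂ) * L.η₁ + (b b' : ℂ) * L.η₂) := by
          simp only [Finset.mul_sum, Finset.sum_mul]
          rw [Finset.sum_comm]
          exact Finset.sum_congr rfl fun b' _ => Finset.sum_congr rfl fun e _ => by ring
      _ = ∑ b', (∑ k, (κM x k : ℂ) * (S.mv b' k : ℂ)) * ((a b' : ℂ) * L.η₁ + (b b' : ℂ) * L.η₂) := by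
          simp only [hκ]
      _ = ∑ k, (κM x k : ℂ) * ((∑ b', (S.mv b' k : ℂ) * (a b' : ℂ)) * L.η₁ + (∑ b', (S.mv b' k : ℂ) * (b b' : ℂ)) * L.η₂) := by
          simp only [Finset.sum_mul, Finset.mul_sum, mul_add, Finset.sum_add_distrib]
          congr 1
          · rw [Finset.sum_comm]
            exact Finset.sum_congr rfl fun k _ => Finset.sum_congr rfl fun b' _ => by ring
          · rw [Finset.sum_comm]
            exact Finset.sum_congr rfl fun k _ => Finset.sum_congr rfl fun b' _ => by ring
      _ = _ := rfl

/-- A `ℚ̄`-point of `E♮` over `0 ∈ E` has algebraic vector coordinate. [folklore] -/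
theorem _root_.PeriodPair.IsUnivExtAlgPoint.isAlgebraic_of_zero {L : PeriodPair} {t : ℂ}
    (h : L.IsUnivExtAlgPoint 0 t) : IsAlgebraic ℚ t := by
  rcases h with ⟨m, n, hmn, halg⟩ | ⟨h0, -⟩
  · have e : (((0 : ℤ) : ℝ) : ℂ) * L.ω₁ + (((0 : ℤ) : ℝ) : ℂ) * L.ω₂ = ((m : ℝ) : ℂ) * L.ω₁ + ((n : ℝ) : ℂ) * L.ω₂ := by
      push_cast; simpa using hmn
    obtain ⟨h1, h2⟩ := L.real_coords_unique e
    have hm : m = 0 := by exact_mod_cast h1.symm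
    have hn : n = 0 := by exact_mod_cast h2.symm
    subst hm; subst hn
    simpa using halg
  · exact absurd (zero_mem _) h0

/-- **Algebraic points of `K₀` with torsion abelian part come from such points of `M_κ'`.**
[folklore] -/
theorem mem_AlgTors_of_ι {L : PeriodPair} (h₂ : IsAlgebraic ℚ L.g₂) (h₃ : IsAlgebraic ℚ L.g₃)
    {w : S.σ' → ℂ} (hw : S.ι w ∈ AlgTors L κM) : w ∈ AlgTors L S.κS := by
  obtain ⟨⟨hy, t, hzt, hs⟩, htor⟩ := hw
  -- the blocks of `w` through the integer left inverses
  have hwy : ∀ j', w (iy j') = ∑ i, (S.pA j' i : ℂ) * S.ι w (iy i) := fun j' => (S.pA_ι w j').symm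
  have hwz : ∀ b', w (iz b') = ∑ k, (S.pC b' k : ℂ) * S.ι w (iz k) := fun b' => (S.pC_ι w b').symm
  -- the new fibre representatives `t''_{b'} = ∑_k pC_{b'k} t_k` and `t̂ = m t''`
  set t'' : Fin S.nC → ℂ := fun b' => ∑ k, (S.pC b' k : ℂ) * t k with ht''
  set that : γ → ℂ := fun k => ∑ b', (S.mv b' k : ℂ) * t'' b' with hthat
  -- `z = m z''` and `(z, t̂)` is a `ℚ̄`-point, so `t - t̂` is algebraic
  have hz'' : ∀ b', L.IsUnivExtAlgPoint (w (iz b')) (t'' b') := by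
    intro b'
    rw [hwz b', ht'']
    exact PeriodPair.IsUnivExtAlgPoint.sum_int_mul h₂ h₃ _ _ _ _ fun k _ => hzt k
  have hzhat : ∀ k, L.IsUnivExtAlgPoint (S.ι w (iz k)) (that k) := by
    intro k
    rw [ι_iz, hthat]
    exact PeriodPair.IsUnivExtAlgPoint.sum_int_mul h₂ h₃ _ _ _ _ fun b' _ => hz'' b'
  have hu : ∀ k, IsAlgebraic ℚ (t k - that k) := by
    intro k
    have hsub := (hzt k).sub h₂ h₃ (hzhat k)
    rw [sub_self] at hsub
    exact hsub.isAlgebraic_of_zero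
  refine ⟨⟨fun j' => ?_, t'', hz'', fun e' => ?_⟩, fun b' => ?_⟩
  · -- torus: `e^{w_y j'} = ∏ (e^{y_i})^{pA}`
    rw [hwy j', Complex.exp_sum]
    refine Finset.prod_induction _ (fun x => IsAlgebraic ℚ x) (fun a b ha hb => ha.mul hb)
      isAlgebraic_one fun i _ => ?_
    rw [Complex.exp_int_mul]
    exact isAlgebraic_zpow (hy i) _
  · -- fibre: the vector `W_e = w_s e - ∑ κ' t''` has `σ W` algebraic, hence is algebraic
    set W : Fin S.nΞ → ℂ := fun e => w (is e) - ∑ b', (S.κS e b' : ℂ) * t'' b' with hW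
    show IsAlgebraic ℚ (W e')
    have hκ : ∀ b' x, (∑ k, (κM x k : ℂ) * (S.mv b' k : ℂ)) = ∑ e, (S.κS e b' : ℂ) * (S.sv e x : ℂ) := by
      intro b' x
      have := congrArg (algebraMap Kbar ℂ) (S.κS_spec b' x)
      simpa [map_sum, map_mul] using this
    -- `∑_k κ_{xk} t̂_k = ∑_e σ_e(x) ∑_b' κ'_{eb'} t''_b'`
    have hthat' : ∀ x, ∑ k, (κM x k : ℂ) * that k = ∑ e, (S.sv e x : ℂ) * ∑ b', (S.κS e b' : ℂ) * t'' b' := by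
      intro x
      calc ∑ k, (κM x k : ℂ) * that k = ∑ b', (∑ k, (κM x k : ℂ) * (S.mv b' k : ℂ)) * t'' b' := by
            simp only [hthat, Finset.mul_sum, Finset.sum_mul]
            rw [Finset.sum_comm]
            exact Finset.sum_congr rfl fun b' _ => Finset.sum_congr rfl fun k _ => by ring
        _ = ∑ b', (∑ e, (S.κS e b' : ℂ) * (S.sv e x : ℂ)) * t'' b' := by simp only [hκ]
        _ = ∑ e, (S.sv e x : ℂ) * ∑ b', (S.κS e b' : ℂ) * t'' b' := by
            simp only [Finset.mul_sum, Finset.sum_mul]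
            rw [Finset.sum_comm]
            exact Finset.sum_congr rfl fun e _ => Finset.sum_congr rfl fun b' _ => by ring
    -- `(σ W)_x = (ι w)_s(x) - ∑ κ t + ∑ κ (t - t̂)` is algebraic
    have hV : ∀ x, ∑ e, (S.sv e x : ℂ) * W e =
        (S.ι w (is x) - ∑ k, (κM x k : ℂ) * t k) + ∑ k, (κM x k : ℂ) * (t k - that k) := by
      intro x
      have e1 : ∑ e, (S.sv e x : ℂ) * W e = S.ι w (is x) - ∑ k, (κM x k : ℂ) * that k := by
        rw [hthat' x, ι_is, ← Finset.sum_sub_distrib]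
        exact Finset.sum_congr rfl fun e _ => by rw [hW]; ring
      rw [e1]
      simp only [mul_sub, Finset.sum_sub_distrib]
      ring
    have hValg : ∀ x, IsAlgebraic ℚ (∑ e, (S.sv e x : ℂ) * W e) := by
      intro x
      rw [hV x]
      refine (hs x).add ?_
      refine Finset.sum_induction _ (fun y => IsAlgebraic ℚ y) (fun a b ha hb => ha.add hb)
        isAlgebraic_zero fun k _ => (isAlgebraic_coe_Kbar (κM x k)).mul (hu k)
    -- `σ W` has algebraic coordinates: it is a `ℚ̄`-point of `span(σ)`
    let VK : δ → Kbar := fun x => ⟨∑ e, (S.sv e x : ℂ) * W e, mem_algebraicClosure_iff.mpr (hValg x)⟩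
    have hVKx : ∀ x, ((VK x : Kbar) : ℂ) = ∑ e, (S.sv e x : ℂ) * W e := fun x => rfl
    have hVKmem : VK ∈ kPoints Kbar (span ℂ (ofK Kbar (L := ℂ) '' Set.range S.sv)) := by
      rw [mem_kPoints]
      have hofK : ofK Kbar (L := ℂ) VK = ∑ e, W e • ofK Kbar (L := ℂ) (S.sv e) := by
        funext x
        rw [ofK_apply, show algebraMap Kbar ℂ (VK x) = ((VK x : Kbar) : ℂ) from rfl, hVKx x]
        simp only [Finset.sum_apply, Pi.smul_apply, smul_eq_mul, ofK_apply]
        exact Finset.sum_congr rfl fun e _ => by rw [mul_comm]; rfl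
      rw [hofK]
      exact Submodule.sum_mem _ fun e _ => Submodule.smul_mem _ _ (subset_span ⟨S.sv e, ⟨e, rfl⟩, rfl⟩)
    rw [kPoints_span_ofK, Submodule.mem_span_range_iff_exists_fun] at hVKmem
    obtain ⟨c, hc⟩ := hVKmem
    -- compare coefficients: `W = c`
    have hWc : (fun e => W e - (c e : ℂ)) = 0 := by
      refine S.eq_zero_of_sv_sum fun x => ?_
      have h2 : ∑ e, (S.sv e x : ℂ) * (c e : ℂ) = ∑ e, (S.sv e x : ℂ) * W e := by
        rw [← hVKx x, show ((VK x : Kbar) : ℂ) = algebraMap Kbar ℂ (VK x) from rfl, ← congr_fun hc x]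
        simp only [Finset.sum_apply, Pi.smul_apply, smul_eq_mul, map_sum, map_mul]
        exact Finset.sum_congr rfl fun e _ => by rw [mul_comm]; rfl
      simp only [mul_sub, Finset.sum_sub_distrib, h2, sub_self]
    have := congr_fun hWc e'
    simp only [Pi.zero_apply, sub_eq_zero] at this
    rw [this]
    exact isAlgebraic_coe_Kbar (c e')
  · -- torsion
    rw [hwz b']
    exact PeriodPair.IsTorsionPt.sum_int_mul _ _ _ fun k _ => htor k

/-! ### Rationality and dimensions of `ι⁻¹(𝔟)` -/

/-- The pull-back of a `ℚ̄`-form along `ι`. [folklore] -/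
def pullForm (θ : β ⊕ (γ ⊕ δ) → Kbar) : S.σ' → Kbar :=
  Std.coords (fun j => ∑ i, θ (iy i) * (S.av j i : Kbar)) (fun b => ∑ k, θ (iz k) * (S.mv b k : Kbar))
    (fun e => ∑ x, θ (is x) * S.sv e x)

/-- `⟨θ, ι w⟩ = ⟨ι^*θ, w⟩`. [folklore] -/
theorem pair_ι (θ : β ⊕ (γ ⊕ δ) → Kbar) (w : S.σ' → ℂ) :
    ∑ t, (θ t : ℂ) * S.ι w t = pair Kbar (S.pullForm θ) w := by
  simp only [pair]
  rw [sum_blocks, sum_blocks]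
  have hc : ∀ x : Kbar, algebraMap Kbar ℂ x = (x : ℂ) := fun x => rfl
  congr 1
  · congr 1
    · simp only [ι_iy, pullForm, coords_iy, map_sum, map_mul, Finset.mul_sum, Finset.sum_mul]
      rw [Finset.sum_comm]
      refine Finset.sum_congr rfl fun j _ => Finset.sum_congr rfl fun i _ => ?_
      simp only [hc]; push_cast; ring
    · simp only [ι_iz, pullForm, coords_iz, map_sum, map_mul, Finset.mul_sum, Finset.sum_mul]
      rw [Finset.sum_comm]
      refine Finset.sum_congr rfl fun b _ => Finset.sum_congr rfl fun k _ => ?_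
      simp only [hc]; push_cast; ring
  · simp only [ι_is, pullForm, coords_is, map_sum, map_mul, Finset.mul_sum, Finset.sum_mul]
    rw [Finset.sum_comm]
    refine Finset.sum_congr rfl fun e _ => Finset.sum_congr rfl fun x _ => ?_
    simp only [hc]; ring

/-- **`ι⁻¹(𝔟)` is `ℚ̄`-rational** for a `ℚ̄`-rational `𝔟`: it is the solution space of the pulled-back
`ℚ̄`-forms cutting out `𝔟`. [folklore] -/
theorem isKRational_comap {𝔟 : Submodule ℂ (β ⊕ (γ ⊕ δ) → ℂ)} (hrat : IsKRational Kbar 𝔟) :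
    IsKRational Kbar (𝔟.comap S.ι) := by
  obtain ⟨T, hT⟩ := hrat.dotAnn Kbar
  have h𝔟 : 𝔟 = dotAnn (dotAnn 𝔟) := (dotAnn_dotAnn 𝔟).symm
  have e : 𝔟.comap S.ι = solSpace Kbar (S.pullForm '' T) := by
    ext w
    rw [Submodule.mem_comap, mem_solSpace]
    constructor
    · intro hw
      rintro _ ⟨θ, hθ, rfl⟩
      rw [← pair_ι]
      have hθ' : ofK Kbar (L := ℂ) θ ∈ dotAnn 𝔟 := by rw [hT]; exact subset_span ⟨θ, hθ, rfl⟩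
      have := (mem_dotAnn.mp hθ') (S.ι w) hw
      rw [← this]
      exact Finset.sum_congr rfl fun t _ => by rw [ofK_apply, mul_comm]; rfl
    · intro hw
      rw [h𝔟, mem_dotAnn]
      intro θ hθ
      rw [hT] at hθ
      induction hθ using Submodule.span_induction with
      | mem x hx =>
        obtain ⟨θ₀, hθ₀, rfl⟩ := hx
        have := hw _ ⟨θ₀, hθ₀, rfl⟩
        rw [← pair_ι] at this
        rw [← this]
        exact Finset.sum_congr rfl fun t _ => by rw [ofK_apply]; rfl
      | zero => simp
      | add x y _ _ hx hy => simp [add_mul, Finset.sum_add_distrib, hx, hy]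
      | smul r x _ hx => simp [mul_assoc, ← Finset.mul_sum, hx]
  rw [e]
  exact isKRational_solSpace Kbar _

/-- `ι(ι⁻¹(𝔟)) = 𝔟 ∩ Lie K₀`. [folklore] -/
theorem map_comap (𝔟 : Submodule ℂ (β ⊕ (γ ⊕ δ) → ℂ)) : (𝔟.comap S.ι).map S.ι = 𝔟 ⊓ D₀.tangent := by
  rw [Submodule.map_comap_eq, S.range_ι, inf_comm]

/-- `dim ι⁻¹(𝔟) = dim(𝔟 ∩ Lie K₀)`. [folklore] -/
theorem finrank_comap (𝔟 : Submodule ℂ (β ⊕ (γ ⊕ δ) → ℂ)) :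
    finrank ℂ ↥(𝔟.comap S.ι) = finrank ℂ ↥(𝔟 ⊓ D₀.tangent) := by
  rw [← S.map_comap 𝔟]
  exact (Submodule.equivMapOfInjective S.ι S.ι_injective _).finrank_eq

/-! ### Push-forward of subgroups of `M_κ'` to subgroups of `M_κ` inside `K₀` -/

/-- Evaluation of rational `y`-forms on the `a⁽ʲ⁾`. [folklore] -/
def evA : (β → ℚ) →ₗ[ℚ] (Fin S.nA → ℚ) where
  toFun q := fun j => ∑ i, q i * (S.av j i : ℚ)
  map_add' a b := by funext j; simp [add_mul, Finset.sum_add_distrib]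
  map_smul' c a := by funext j; simp [Finset.mul_sum, mul_assoc]

/-- Evaluation of rational `z`-forms on the `m⁽ᵇ⁾`. [folklore] -/
def evC : (γ → ℚ) →ₗ[ℚ] (Fin S.nC → ℚ) where
  toFun c := fun b => ∑ k, c k * (S.mv b k : ℚ)
  map_add' a b := by funext j; simp [add_mul, Finset.sum_add_distrib]
  map_smul' c a := by funext j; simp [Finset.mul_sum, mul_assoc]

/-- Evaluation of `ℚ̄`-`s`-forms on the `σ⁽ᵉ⁾`. [folklore] -/
def evΞ : (δ → Kbar) →ₗ[Kbar] (Fin S.nΞ → Kbar) where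
  toFun θ := fun e => ∑ x, θ x * S.sv e x
  map_add' a b := by funext e; simp [add_mul, Finset.sum_add_distrib]
  map_smul' c a := by funext e; simp [Finset.mul_sum, mul_assoc]

/-- `evΞ` is onto (the `σ⁽ᵉ⁾` are linearly independent; dimension count). [folklore] -/
theorem evΞ_surjective : Function.Surjective S.evΞ := by
  classical
  -- `ker evΞ = (span σ)^⊥`, of dimension `|δ| - n`
  have hker : LinearMap.ker S.evΞ = dotAnn (span Kbar (Set.range S.sv)) := by
    ext θ
    rw [LinearMap.mem_ker, mem_dotAnn]
    constructor
    · intro h u hu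
      induction hu using Submodule.span_induction with
      | mem x hx =>
        obtain ⟨e, rfl⟩ := hx
        have := congr_fun h e
        simp only [evΞ, LinearMap.coe_mk, AddHom.coe_mk, Pi.zero_apply] at this
        rw [← this]
        exact Finset.sum_congr rfl fun x _ => mul_comm _ _
      | zero => simp
      | add x y _ _ hx hy => simp [add_mul, Finset.sum_add_distrib, hx, hy]
      | smul r x _ hx => simp [mul_assoc, ← Finset.mul_sum, hx]
    · intro h
      funext e
      have := h (S.sv e) (subset_span ⟨e, rfl⟩)
      simp only [evΞ, LinearMap.coe_mk, AddHom.coe_mk, Pi.zero_apply]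
      rw [← this]
      exact Finset.sum_congr rfl fun x _ => mul_comm _ _
  have hdim : finrank Kbar ↥(span Kbar (Set.range S.sv)) = S.nΞ := by
    rw [finrank_span_eq_card S.sv_indep, Fintype.card_fin]
  have h1 := LinearMap.finrank_range_add_finrank_ker S.evΞ
  have h2 := finrank_dotAnn_add (span Kbar (Set.range S.sv))
  rw [hker] at h1
  rw [hdim] at h2
  rw [Module.finrank_fintype_fun_eq_card] at h1
  have hr : finrank Kbar ↥(LinearMap.range S.evΞ) = finrank Kbar (Fin S.nΞ → Kbar) := by
    rw [Module.finrank_fintype_fun_eq_card, Fintype.card_fin]; omega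
  rw [← LinearMap.range_eq_top]
  exact Submodule.eq_top_of_finrank_eq hr

/-- **A `ℚ̄`-form on `𝔾ₐ^γ`-directions killing all `m⁽ᵇ⁾` lies in the `ℚ̄`-span of `C₀`**
(double annihilator of the rational subspace `C₀`). [folklore] -/
theorem form_mem_span_C {ψ : γ → Kbar} (hψ : ∀ b, ∑ k, ψ k * (S.mv b k : Kbar) = 0) :
    ψ ∈ span Kbar ((fun c : γ → ℚ => fun k => (c k : Kbar)) '' (D₀.C : Set (γ → ℚ))) := by
  set V : Submodule Kbar (γ → Kbar) := span Kbar ((fun c : γ → ℚ => fun k => (c k : Kbar)) '' (D₀.C : Set (γ → ℚ))) with hV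
  rw [← dotAnn_dotAnn V, mem_dotAnn]
  intro u hu
  -- `u ∈ V^⊥` is a `ℚ̄`-combination of the `m⁽ᵇ⁾`
  have hu' : u ∈ solSpace ℚ (L := Kbar) (D₀.C : Set (γ → ℚ)) := by
    intro c hc
    simp only [pair, eq_ratCast]
    exact (mem_dotAnn.mp hu) _ (subset_span ⟨c, hc, rfl⟩)
  rw [solSpace_eq_span] at hu'
  have hle : span Kbar (ofK ℚ (L := Kbar) '' {w : γ → ℚ | ∀ c ∈ (D₀.C : Set (γ → ℚ)), ∑ k, c k * w k = 0}) ≤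
      span Kbar (Set.range fun b => fun k => (S.mv b k : Kbar)) := by
    refine span_le.mpr ?_
    rintro _ ⟨w, hw, rfl⟩
    have hw' := S.mv_span w hw
    rw [Submodule.mem_span_range_iff_exists_fun] at hw'
    obtain ⟨r, hr⟩ := hw'
    have e : ofK ℚ (L := Kbar) w = ∑ b, (r b : Kbar) • fun k => (S.mv b k : Kbar) := by
      funext k
      have := congr_fun hr k
      simp only [Finset.sum_apply, Pi.smul_apply, smul_eq_mul] at this
      simp only [ofK_apply, eq_ratCast, Finset.sum_apply, Pi.smul_apply, smul_eq_mul]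
      rw [← this]; push_cast; rfl
    rw [e]
    exact Submodule.sum_mem _ fun b _ => Submodule.smul_mem _ _ (subset_span ⟨b, rfl⟩)
  have hu'' := hle hu'
  rw [Submodule.mem_span_range_iff_exists_fun] at hu''
  obtain ⟨r, rfl⟩ := hu''
  simp only [Finset.sum_apply, Pi.smul_apply, smul_eq_mul, Finset.sum_mul]
  rw [Finset.sum_comm]
  refine Finset.sum_eq_zero fun b _ => ?_
  have : ∑ k, r b * (S.mv b k : Kbar) * ψ k = r b * ∑ k, ψ k * (S.mv b k : Kbar) := by
    rw [Finset.mul_sum]; exact Finset.sum_congr rfl fun k _ => by ring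
  rw [this, hψ b, mul_zero]

/-- The connected algebraic subgroup of `M_κ` inside `K₀` corresponding to a connected algebraic
subgroup of `K₀ = M_κ'`: forms whose restrictions to `Lie K₀` lie in the given data. [folklore] -/
def push (D' : SubgroupData (Fin S.nA) (Fin S.nC) (Fin S.nΞ) S.κS) : SubgroupData β γ δ κM where
  A := D'.A.comap S.evA
  C := D'.C.comap S.evC
  Ξ := D'.Ξ.comap S.evΞ
  compat := by
    intro θ hθ
    rw [Submodule.mem_comap] at hθ
    have hc := D'.compat (S.evΞ θ) hθ
    -- the form `φ = θ ∘ κ`, its values `A` on the `m⁽ᵇ⁾`, and its projection `Rφ`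
    set φ : γ → Kbar := fun k => ∑ x, θ x * κM x k with hφ
    set A : Fin S.nC → Kbar := fun b' => ∑ k, φ k * (S.mv b' k : Kbar) with hA
    set Rφ : γ → Kbar := fun k' => ∑ b', A b' * (S.pC b' k' : Kbar) with hRφ
    -- `φ · m⁽ᵇ'⁾ = ((evΞ θ) ∘ κ')_{b'}`
    have hφm : ∀ b', A b' = ∑ e, S.evΞ θ e * S.κS e b' := by
      intro b'
      rw [hA]
      simp only [hφ, evΞ, LinearMap.coe_mk, AddHom.coe_mk, Finset.sum_mul]
      rw [Finset.sum_comm]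
      simp only [mul_assoc, ← Finset.mul_sum, S.κS_spec b']
      simp only [Finset.mul_sum]
      rw [Finset.sum_comm]
      exact Finset.sum_congr rfl fun e _ => Finset.sum_congr rfl fun x _ => by ring
    -- `φ - Rφ` kills every `m⁽ᵇ⁾`, hence lies in `span C₀ ⊆ span (push C)`
    have hdiff : ∀ b, ∑ k, (φ k - Rφ k) * (S.mv b k : Kbar) = 0 := by
      intro b
      have e2 : ∑ k', Rφ k' * (S.mv b k' : Kbar) = A b := by
        simp only [hRφ, Finset.sum_mul]
        rw [Finset.sum_comm]
        have key : ∀ b', ∑ k', A b' * (S.pC b' k' : Kbar) * (S.mv b k' : Kbar) = A b' * (if b = b' then 1 else 0) := by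
          intro b'
          have h := congrArg (fun n : ℤ => (n : Kbar)) (S.pC_spec b b')
          push_cast at h
          rw [← h, Finset.mul_sum]
          exact Finset.sum_congr rfl fun k' _ => by ring
        simp only [key, mul_ite, mul_one, mul_zero, Finset.sum_ite_eq, Finset.mem_univ, if_true]
      have e1 : ∑ k, (φ k - Rφ k) * (S.mv b k : Kbar) = ∑ k, φ k * (S.mv b k : Kbar) - ∑ k', Rφ k' * (S.mv b k' : Kbar) := by
        rw [← Finset.sum_sub_distrib]; exact Finset.sum_congr rfl fun k _ => by ring
      rw [e1, e2]
      exact sub_self _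
    have hmono : span Kbar ((fun c : γ → ℚ => fun k => (c k : Kbar)) '' (D₀.C : Set (γ → ℚ))) ≤
        span Kbar ((fun c : γ → ℚ => fun k => (c k : Kbar)) '' ((D'.C.comap S.evC : Submodule ℚ (γ → ℚ)) : Set (γ → ℚ))) := by
      refine span_mono (Set.image_mono fun c hc => ?_)
      show S.evC c ∈ D'.C
      have : S.evC c = 0 := by
        funext b
        simp only [evC, LinearMap.coe_mk, AddHom.coe_mk, Pi.zero_apply]
        exact S.mv_perp c hc b
      rw [this]; exact D'.C.zero_mem
    have h1 : (fun k => φ k - Rφ k) ∈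
        span Kbar ((fun c : γ → ℚ => fun k => (c k : Kbar)) '' ((D'.C.comap S.evC : Submodule ℚ (γ → ℚ)) : Set (γ → ℚ))) :=
      hmono (S.form_mem_span_C hdiff)
    -- `Rφ ∈ span (push C)`: it is the image of `(evΞ θ) ∘ κ' ∈ span C'` under `v ↦ ∑ v_{b'} pC⁽ᵇ'⁾`
    have h2 : Rφ ∈ span Kbar ((fun c : γ → ℚ => fun k => (c k : Kbar)) '' ((D'.C.comap S.evC : Submodule ℚ (γ → ℚ)) : Set (γ → ℚ))) := by
      have hR : Rφ = ∑ b', (∑ e, S.evΞ θ e * S.κS e b') • fun k' => (S.pC b' k' : Kbar) := by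
        funext k'
        rw [hRφ, Finset.sum_apply]
        exact Finset.sum_congr rfl fun b' _ => by rw [Pi.smul_apply, smul_eq_mul, hφm b']
      rw [hR]
      have key : ∀ lam ∈ span Kbar ((fun c : Fin S.nC → ℚ => fun b => (c b : Kbar)) '' (D'.C : Set (Fin S.nC → ℚ))),
          (∑ b', lam b' • fun k' => (S.pC b' k' : Kbar)) ∈
            span Kbar ((fun c : γ → ℚ => fun k => (c k : Kbar)) '' ((D'.C.comap S.evC : Submodule ℚ (γ → ℚ)) : Set (γ → ℚ))) := by
        intro lam hlam
        induction hlam using Submodule.span_induction with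
        | mem x hx =>
          obtain ⟨c', hc', rfl⟩ := hx
          refine subset_span ⟨fun k' => ∑ b', c' b' * (S.pC b' k' : ℚ), ?_, ?_⟩
          · show S.evC _ ∈ D'.C
            have : S.evC (fun k' => ∑ b', c' b' * (S.pC b' k' : ℚ)) = c' := by
              funext b
              simp only [evC, LinearMap.coe_mk, AddHom.coe_mk, Finset.sum_mul]
              rw [Finset.sum_comm]
              have key' : ∀ b', ∑ k, c' b' * (S.pC b' k : ℚ) * (S.mv b k : ℚ) = c' b' * (if b = b' then 1 else 0) := by
                intro b'
                have h := congrArg (fun n : ℤ => (n : ℚ)) (S.pC_spec b b')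
                push_cast at h
                rw [← h, Finset.mul_sum]
                exact Finset.sum_congr rfl fun k _ => by ring
              simp only [key', mul_ite, mul_one, mul_zero, Finset.sum_ite_eq, Finset.mem_univ, if_true]
            rw [this]; exact hc'
          · funext k'
            simp [Finset.sum_apply, Pi.smul_apply]
        | zero => simp
        | add x y _ _ hx hy =>
          simp only [Pi.add_apply, add_smul, Finset.sum_add_distrib]
          exact Submodule.add_mem _ hx hy
        | smul r x _ hx =>
          simp only [Pi.smul_apply, smul_eq_mul, ← smul_smul, ← Finset.smul_sum]
          exact Submodule.smul_mem _ _ hx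
      exact key _ hc
    have hsplit : φ = (fun k => φ k - Rφ k) + Rφ := by
      funext k; simp
    have hgoal : φ ∈ span Kbar ((fun c : γ → ℚ => fun k => (c k : Kbar)) '' ((D'.C.comap S.evC : Submodule ℚ (γ → ℚ)) : Set (γ → ℚ))) := by
      rw [hsplit]
      exact Submodule.add_mem _ h1 h2
    exact hgoal

/-- `Lie(push K) = ι(Lie K)`. [folklore] -/
theorem push_tangent (D' : SubgroupData (Fin S.nA) (Fin S.nC) (Fin S.nΞ) S.κS) :
    (S.push D').tangent = D'.tangent.map S.ι := by
  classical
  refine le_antisymm ?_ ?_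
  · intro w hw
    obtain ⟨hA, hC, hΞ⟩ := (SubgroupData.mem_tangent_iff _ w).mp hw
    -- `w ∈ Lie K₀`, so `w = ι w'`
    have hw₀ : w ∈ D₀.tangent := by
      rw [SubgroupData.mem_tangent_iff]
      refine ⟨fun q hq => hA q ?_, fun c hc => hC c ?_, fun ξ hξ => hΞ ξ ?_⟩
      · show S.evA q ∈ D'.A
        have : S.evA q = 0 := by
          funext j; simp only [evA, LinearMap.coe_mk, AddHom.coe_mk, Pi.zero_apply]; exact S.av_perp q hq j
        rw [this]; exact D'.A.zero_mem
      · show S.evC c ∈ D'.C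
        have : S.evC c = 0 := by
          funext b; simp only [evC, LinearMap.coe_mk, AddHom.coe_mk, Pi.zero_apply]; exact S.mv_perp c hc b
        rw [this]; exact D'.C.zero_mem
      · show S.evΞ ξ ∈ D'.Ξ
        have : S.evΞ ξ = 0 := by
          funext e; simp only [evΞ, LinearMap.coe_mk, AddHom.coe_mk, Pi.zero_apply]; exact S.sv_perp ξ hξ e
        rw [this]; exact D'.Ξ.zero_mem
    obtain ⟨w', rfl⟩ := S.exists_eq_ι hw₀
    refine ⟨w', ?_, rfl⟩
    show w' ∈ D'.tangent
    rw [SubgroupData.mem_tangent_iff]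
    refine ⟨fun q' hq' => ?_, fun c' hc' => ?_, fun ξ' hξ' => ?_⟩
    · -- the form `q = ∑ q'_j pA⁽ʲ⁾` restricts to `q'`
      have hq : S.evA (fun i => ∑ j', q' j' * (S.pA j' i : ℚ)) = q' := by
        funext j
        simp only [evA, LinearMap.coe_mk, AddHom.coe_mk, Finset.sum_mul]
        rw [Finset.sum_comm]
        have key : ∀ j', ∑ i, q' j' * (S.pA j' i : ℚ) * (S.av j i : ℚ) = q' j' * (if j = j' then 1 else 0) := by
          intro j'
          have h := congrArg (fun n : ℤ => (n : ℚ)) (S.pA_spec j j')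
          push_cast at h
          rw [← h, Finset.mul_sum]
          exact Finset.sum_congr rfl fun i _ => by ring
        simp only [key, mul_ite, mul_one, mul_zero, Finset.sum_ite_eq, Finset.mem_univ, if_true]
      have := hA _ (show S.evA _ ∈ D'.A by rw [hq]; exact hq')
      -- `∑_i q_i (ι w')_i = ∑_j' q'_j' w'_j'`
      rw [← this]
      simp only [Rat.cast_sum, Rat.cast_mul, Rat.cast_intCast, Finset.sum_mul]
      rw [Finset.sum_comm]
      refine Finset.sum_congr rfl fun j' _ => ?_
      rw [← S.pA_ι w' j', Finset.mul_sum]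
      exact Finset.sum_congr rfl fun i _ => by ring
    · have hq : S.evC (fun k => ∑ b', c' b' * (S.pC b' k : ℚ)) = c' := by
        funext b
        simp only [evC, LinearMap.coe_mk, AddHom.coe_mk, Finset.sum_mul]
        rw [Finset.sum_comm]
        have key : ∀ b', ∑ k, c' b' * (S.pC b' k : ℚ) * (S.mv b k : ℚ) = c' b' * (if b = b' then 1 else 0) := by
          intro b'
          have h := congrArg (fun n : ℤ => (n : ℚ)) (S.pC_spec b b')
          push_cast at h
          rw [← h, Finset.mul_sum]
          exact Finset.sum_congr rfl fun k _ => by ring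
        simp only [key, mul_ite, mul_one, mul_zero, Finset.sum_ite_eq, Finset.mem_univ, if_true]
      have := hC _ (show S.evC _ ∈ D'.C by rw [hq]; exact hc')
      rw [← this]
      simp only [Rat.cast_sum, Rat.cast_mul, Rat.cast_intCast, Finset.sum_mul]
      rw [Finset.sum_comm]
      refine Finset.sum_congr rfl fun b' _ => ?_
      rw [← S.pC_ι w' b', Finset.mul_sum]
      exact Finset.sum_congr rfl fun k _ => by ring
    · obtain ⟨θ, hθ⟩ := S.evΞ_surjective ξ'
      have := hΞ θ (show S.evΞ θ ∈ D'.Ξ by rw [hθ]; exact hξ')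
      rw [← hθ, ← this]
      simp only [evΞ, LinearMap.coe_mk, AddHom.coe_mk, ι_is, Finset.mul_sum]
      push_cast
      simp only [Finset.sum_mul]
      rw [Finset.sum_comm]
      exact Finset.sum_congr rfl fun x _ => Finset.sum_congr rfl fun e _ => by ring
  · rintro _ ⟨w', hw', rfl⟩
    obtain ⟨hA, hC, hΞ⟩ := (SubgroupData.mem_tangent_iff _ w').mp hw'
    rw [SubgroupData.mem_tangent_iff]
    refine ⟨fun q hq => ?_, fun c hc => ?_, fun θ hθ => ?_⟩
    · have := hA (S.evA q) hq
      simp only [evA, LinearMap.coe_mk, AddHom.coe_mk, Rat.cast_sum, Rat.cast_mul, Rat.cast_intCast, Finset.sum_mul] at this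
      rw [Finset.sum_comm] at this
      simp only [ι_iy, Finset.mul_sum]
      rw [← this]
      exact Finset.sum_congr rfl fun i _ => Finset.sum_congr rfl fun j _ => by ring
    · have := hC (S.evC c) hc
      simp only [evC, LinearMap.coe_mk, AddHom.coe_mk, Rat.cast_sum, Rat.cast_mul, Rat.cast_intCast, Finset.sum_mul] at this
      rw [Finset.sum_comm] at this
      simp only [ι_iz, Finset.mul_sum]
      rw [← this]
      exact Finset.sum_congr rfl fun k _ => Finset.sum_congr rfl fun b _ => by ring
    · have := hΞ (S.evΞ θ) hθ
      simp only [evΞ, LinearMap.coe_mk, AddHom.coe_mk] at this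
      push_cast at this
      simp only [Finset.sum_mul] at this
      rw [Finset.sum_comm] at this
      simp only [ι_is, Finset.mul_sum]
      rw [← this]
      exact Finset.sum_congr rfl fun x _ => Finset.sum_congr rfl fun e _ => by ring

/-- `Lie(push K) ⊆ Lie K₀`. [folklore] -/
theorem push_tangent_le (D' : SubgroupData (Fin S.nA) (Fin S.nC) (Fin S.nΞ) S.κS) :
    (S.push D').tangent ≤ D₀.tangent := by
  rw [push_tangent, ← S.range_ι]; exact LinearMap.map_le_range

/-! ### The transport theorem -/

/-- **Transport to a borderline subgroup.** Let `𝔟 ⊊ Lie M_κ` be `ℚ̄`-rational and semistable,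
and `0 ≠ K₀ ≠ M_κ` a connected algebraic subgroup (`ℚ̄`-data) which is BORDERLINE for `𝔟`:
`dim 𝔟·(n - dim 𝔨₀) = (dim 𝔟 - dim(𝔟 ∩ 𝔨₀))·n`. Then `ι⁻¹(𝔟) ⊆ Lie M_κ' = Lie K₀` is
`ℚ̄`-rational, proper, and semistable in `M_κ'`.
[cite: BakerWustholz2007, §6.7 (index), §6.8 (p. 115: "B ∩ ker π and ker π")] -/
theorem transport {𝔟 : Submodule ℂ (β ⊕ (γ ⊕ δ) → ℂ)} (hrat : IsKRational Kbar 𝔟) (h𝔟 : 𝔟 ≠ ⊤)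
    (hss : Semistable κM 𝔟) (hD₀top : D₀.tangent ≠ ⊤) (hD₀bot : D₀.tangent ≠ ⊥)
    (hbord : finrank ℂ 𝔟 * (Fintype.card (β ⊕ (γ ⊕ δ)) - finrank ℂ D₀.tangent) =
      (finrank ℂ 𝔟 - finrank ℂ ↥(𝔟 ⊓ D₀.tangent)) * Fintype.card (β ⊕ (γ ⊕ δ))) :
    IsKRational Kbar (𝔟.comap S.ι) ∧ 𝔟.comap S.ι ≠ ⊤ ∧ Semistable S.κS (𝔟.comap S.ι) := by
  set n := Fintype.card (β ⊕ (γ ⊕ δ)) with hn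
  set d := finrank ℂ 𝔟 with hd
  set k₀ := finrank ℂ D₀.tangent with hk₀
  set i₀ := finrank ℂ ↥(𝔟 ⊓ D₀.tangent) with hi₀
  have hcard : Fintype.card S.σ' = k₀ := S.card_eq
  have hdim𝔟' : finrank ℂ ↥(𝔟.comap S.ι) = i₀ := S.finrank_comap 𝔟
  have hdlt : d < n := by have := Submodule.finrank_lt h𝔟; simpa [hn, hd] using this
  have hk₀n : k₀ ≤ n := by have := Submodule.finrank_le D₀.tangent; simpa [hn, hk₀] using this
  have hi₀d : i₀ ≤ d := Submodule.finrank_mono inf_le_left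
  have hi₀k : i₀ ≤ k₀ := Submodule.finrank_mono inf_le_right
  have hnpos : 0 < n := by omega
  -- (T1) rationality
  have h1 : IsKRational Kbar (𝔟.comap S.ι) := S.isKRational_comap hrat
  -- (T2) properness: `Lie K₀ ⊆ 𝔟` is impossible for a semistable proper `𝔟` and `K₀ ≠ 0`
  have h2 : 𝔟.comap S.ι ≠ ⊤ := by
    intro htop
    have hle : D₀.tangent ≤ 𝔟 := by
      intro w hw
      obtain ⟨w', rfl⟩ := S.exists_eq_ι hw
      have : w' ∈ 𝔟.comap S.ι := by rw [htop]; exact Submodule.mem_top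
      exact this
    have h0 := hss.finrank_eq_zero_of_le h𝔟 D₀ hle
    exact hD₀bot (Submodule.finrank_eq_zero.mp h0)
  -- (T3) semistability
  have h3 : Semistable S.κS (𝔟.comap S.ι) := by
    rintro _ ⟨D', rfl⟩ h𝔨'top
    set P := (S.push D').tangent with hP
    have hPle : P ≤ D₀.tangent := S.push_tangent_le D'
    have hPeq : P = D'.tangent.map S.ι := S.push_tangent D'
    have hPtop : P ≠ ⊤ := fun h => hD₀top (eq_top_iff.mpr (h ▸ hPle))
    have hssP := hss P ⟨S.push D', rfl⟩ hPtop
    -- dimensions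
    set k := finrank ℂ P with hk
    set i := finrank ℂ ↥(𝔟 ⊓ P) with hi
    have hkeq : finrank ℂ ↥D'.tangent = k := by
      rw [hk, hPeq]; exact (Submodule.equivMapOfInjective S.ι S.ι_injective _).finrank_eq
    have hieq : finrank ℂ ↥(𝔟.comap S.ι ⊓ D'.tangent) = i := by
      have e1 : (𝔟.comap S.ι ⊓ D'.tangent).map S.ι = 𝔟 ⊓ P := by
        rw [Submodule.map_inf S.ι S.ι_injective, S.map_comap, ← hPeq, inf_assoc, inf_eq_right.mpr hPle]
      rw [hi, ← e1]
      exact (Submodule.equivMapOfInjective S.ι S.ι_injective _).finrank_eq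
    have hkk₀ : k ≤ k₀ := Submodule.finrank_mono hPle
    have hii₀ : i ≤ i₀ := Submodule.finrank_mono (inf_le_inf_left 𝔟 hPle)
    have hid : i ≤ d := Submodule.finrank_mono inf_le_left
    have hkn : k ≤ n := hkk₀.trans hk₀n
    -- the goal in terms of `i₀, k₀, i, k`
    rw [hcard, hdim𝔟', hkeq, hieq]
    change d * (n - k) ≤ (d - i) * n at hssP
    -- from the borderline equality `d k₀ = i₀ n` and semistability `i n ≤ d k`: `i k₀ ≤ i₀ k`
    have e1 : d * k₀ = i₀ * n := by
      zify [hk₀n, hi₀d] at hbord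
      zify
      linear_combination -hbord
    have e2 : i * n ≤ d * k := by
      zify [hkn, hid] at hssP
      zify
      linarith
    have e3 : i * k₀ ≤ i₀ * k := by
      have : n * (i * k₀) ≤ n * (i₀ * k) := by
        calc n * (i * k₀) = k₀ * (i * n) := by ring
          _ ≤ k₀ * (d * k) := Nat.mul_le_mul_left _ e2
          _ = k * (d * k₀) := by ring
          _ = k * (i₀ * n) := by rw [e1]
          _ = n * (i₀ * k) := by ring
      exact Nat.le_of_mul_le_mul_left this hnpos
    -- `i₀ (k₀ - k) ≤ (i₀ - i) k₀`
    zify [hkk₀, hii₀]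
    zify at e3
    nlinarith [e3]
  exact ⟨h1, h2, h3⟩

end SubData

end Std

end GaGmE

end Literature.NumberTheory.Transcendental

end
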